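import Literature.AlgebraicGeometry.Motives.HodgeThetaSubalgebraUnitaryConstantRankLeviTwo
import HarnessLib

/-!
# Constant-rank Levi algebras III: adjoint ranks, the mirrored inner double Levi, the Levi-pair package, and the
# pencil trick under a full Levi algebra (Ribet 1983 Thm. 3, Lie step — infrastructure for the cells `(14, 15)`,
# `(15, 16)`, `(12, 19)`)

Family `hodge`, layer `Literature/AlgebraicGeometry/Motives` (pure linear algebra over `ℂ`; no geometry). Research
context: cell `pub-hodge-ring2` (HONEST FRAMING: research route conditional on HC_CM; not a corollary; Q11.4-sentence-2
already refuted in dim ≥ 3), Literature lane gen 86, programme R74. UNCONDITIONAL; theorems only, no definition, no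
named fact (D-0026), no `sorry`. Sequel of `HodgeThetaSubalgebraUnitaryConstantRankLevi(Two)`.

THE SETTING is that of the tree's unitary cores (`𝔊 ⊆ End_ℂ(W)` bracket-closed, irreducible, an involution `Θ ∈ 𝔊`
with eigenspaces `P`, `Q`, a Hermitian pairing `s`, `P ⊥ Q`, definite on `P` and on `Q`, `𝔊` adjoint-closed), and,
for a raising `B ∈ 𝔊` of rank `r`, its involution `ι` (`UnitaryLeviKernel.exists_involution`) with the concrete Levi
algebras `L⁻ = 𝔷|_{U⁻}` of `Θ`-type `(r | b − r)` and `L⁺ = 𝔷|_{U⁺}` of `Θ`-type `(a − r | r)`.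

* §1 **`UnitaryAdjointRank.finrank_range_eq`** — an adjoint pair `s(xv, w) = s(v, yw)` whose images meet the null
  cone of `s` trivially has `rk x = rk y` (`ker yx = ker x`, `ker xy = ker y`, rank–nullity).
* §2 **`UnitaryDoubleLevi.eq_top_of_raise_of_core'`** — the MIRRORED inner double Levi: when `dim Q < dim P`, a
  raising `B` of rank `j` still forces `𝔊 = End(W)` as soon as the abstract core of type `(j | a − j)` holds (apply
  `UnitaryDoubleLevi.eq_top_of_raise_of_core` to `−Θ` and the ADJOINT of `B`, which is raising for `−Θ` of the same
  rank by §1). This is what kills the profiles `j ∈ {2, 4, 5}` in a Levi algebra of type `(9 | 6)` and `j = 3` in one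
  of type `(10 | 5)`.
* §3 **`UnitaryLeviSetup.exists_levi_pair`** — the Levi PAIR of a raising operator packaged once: the involution `ι`,
  `U^∓`, the four pieces `B(W)`, `Q ∩ ker B`, `P ∩ U⁺`, `Q ∩ U⁺` characterised by the signs of `(ι, Θ)`, both
  concrete Levi algebras with their unitary axioms (`UnitaryLeviFull.levi_axioms`), and the rank bookkeeping
  `rk X = rk X|_{U⁺} + rk X|_{U⁻}`, `rk X|_{U⁺} ≤ min(a − r, r)`, `rk X|_{U⁻} ≤ min(r, b − r)` for raising `X ∈ 𝔷`.
* §4 **`UnitaryLeviPencil.false_of_full`** (TOOL E, the pencil trick) — if `L⁺` is FULL and `P ∩ U⁺`, `Q ∩ U⁺` have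
  dimension `≥ 3`, no threshold `k` can satisfy «`rk X|_{U⁺} = 2 ⟹ rk X|_{U⁻} ≥ k`» and «`rk X|_{U⁺} = 3 ⟹
  rk X|_{U⁻} < k`» for all raising `X ∈ 𝔷`: lift (`UnitaryLeviFull.exists_raise_lift`) `X = χ₁ ⊗ e₁ + χ₂ ⊗ e₂` and
  `X' = χ₃ ⊗ e₃` for a dual triple; `X + cX'` has `rk|_{U⁺} = 3` for `c ≠ 0` but `rk (X + cX')|_{U⁻} ≥ rk X|_{U⁻}` for
  all but finitely many `c` (`UnitaryGenericRank.exists_finset_finrank_le_add_smul'`).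

## References
* [Ribet1983] K. A. Ribet, *Hodge classes on certain types of abelian varieties*, Amer. J. Math. 105 (1983), Thm. 3.
* [Gordon1997] B. B. Gordon, *A survey of the Hodge conjecture for abelian varieties*, Thm. 6.3 (3), pp. 18–19.
* [Deligne1982HodgeCycles] P. Deligne, *Hodge cycles on abelian varieties*, LNM 900 (1982), I §3 Prop. 3.4, 3.6.
* [GoodmanWallachGTM255] R. Goodman, N. R. Wallach, GTM 255 (2009), §4.1.1 (centralisers of involutions).
* [HoffmanKunze1971LinearAlgebra] K. Hoffman, R. Kunze, *Linear Algebra* (1971), §3.1 Thm. 2 (rank–nullity), §3.5–3.6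
  (dual bases), §6.7 (projections), §8.3 (adjoints).
-/

noncomputable section

open Module

namespace Literature.AlgebraicGeometry.Motives

namespace HodgeStructure

universe u

variable {W : Type u} [AddCommGroup W] [Module ℂ W]

/-! ### §1 Adjoint pairs have equal rank -/

/-- **Adjoint pairs have equal rank.** If `s (x v) w = s v (y w)` for all `v, w`, and `s` vanishes on no non-zero
vector of the images of `x` and of `y`, then `rk x = rk y` (`ker (y x) = ker x`, `ker (x y) = ker y`, rank–nullity).
[cite: HoffmanKunze1971LinearAlgebra, §8.3, §3.1 Thm. 2] -/
theorem UnitaryAdjointRank.finrank_range_eq [FiniteDimensional ℂ W] {s : W → W → ℂ}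
    (hadd : ∀ x y z, s (x + y) z = s x z + s y z) (hsymm : ∀ x y, s y x = starRingEnd ℂ (s x y))
    {x y : Module.End ℂ W} (hxy : ∀ v w, s (x v) w = s v (y w))
    (hdefx : ∀ v, s (x v) (x v) = 0 → x v = 0) (hdefy : ∀ w, s (y w) (y w) = 0 → y w = 0) :
    Module.finrank ℂ (LinearMap.range x) = Module.finrank ℂ (LinearMap.range y) := by
  obtain ⟨-, h0r, h0l, -, -, -, -⟩ := UnitaryTwoOdd.herm_right hadd hsymm
  have hkx : LinearMap.ker (y * x) = LinearMap.ker x := by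
    ext v
    simp only [LinearMap.mem_ker, Module.End.mul_apply]
    refine ⟨fun h => hdefx v ?_, fun h => by rw [h, map_zero]⟩
    rw [hxy, h, h0r]
  have hky : LinearMap.ker (x * y) = LinearMap.ker y := by
    ext w
    simp only [LinearMap.mem_ker, Module.End.mul_apply]
    refine ⟨fun h => hdefy w ?_, fun h => by rw [h, map_zero]⟩
    rw [← hxy, h, h0l]
  have h1 := LinearMap.finrank_range_add_finrank_ker (y * x)
  have h2 := LinearMap.finrank_range_add_finrank_ker x
  have h3 := LinearMap.finrank_range_add_finrank_ker (x * y)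
  have h4 := LinearMap.finrank_range_add_finrank_ker y
  rw [hkx] at h1
  rw [hky] at h3
  have h5 : Module.finrank ℂ (LinearMap.range (y * x)) ≤ Module.finrank ℂ (LinearMap.range y) :=
    Submodule.finrank_mono (by rw [Module.End.mul_eq_comp]; exact LinearMap.range_comp_le_range _ _)
  have h6 : Module.finrank ℂ (LinearMap.range (x * y)) ≤ Module.finrank ℂ (LinearMap.range x) :=
    Submodule.finrank_mono (by rw [Module.End.mul_eq_comp]; exact LinearMap.range_comp_le_range _ _)
  omega

/-! ### §2 The mirrored inner double Levi -/

/-- **The MIRRORED inner double Levi.** In the unitary setting with `dim Q < dim P`, `dim Q ≥ 3`, a raising `B ∈ 𝔊` of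
rank `j > 0` forces `𝔊 = End(W)` as soon as the abstract core of `Θ`-type `(j | a − j)` holds (hypothesis-schema
`hcore`, literally that of `UnitaryDoubleLevi.eq_top_of_raise_of_core` with the roles of `P` and `Q` exchanged):
the adjoint `C` of `B` is raising for `−Θ`, of the same rank (§1), and `UnitaryDoubleLevi.eq_top_of_raise_of_core`
applies to `(−Θ, Q, P, C)`. [cite: Ribet1983, Thm. 3] [cite: Gordon1997, Thm. 6.3 (3)]
[cite: GoodmanWallachGTM255, §4.1.1] [cite: HoffmanKunze1971LinearAlgebra, §8.3] -/
theorem UnitaryDoubleLevi.eq_top_of_raise_of_core' [FiniteDimensional ℂ W] {𝔊 : Submodule ℂ (Module.End ℂ W)}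
    (hbr : ∀ Y ∈ 𝔊, ∀ Z ∈ 𝔊, Y * Z - Z * Y ∈ 𝔊)
    (hirr : ∀ U : Submodule ℂ W, (∀ A ∈ 𝔊, ∀ u ∈ U, A u ∈ U) → U = ⊥ ∨ U = ⊤)
    {Θ : Module.End ℂ W} (hΘ : Θ ∈ 𝔊) (hΘΘ : Θ * Θ = 1)
    {P Q : Submodule ℂ W} (hP : ∀ x, x ∈ P ↔ Θ x = x) (hQ : ∀ x, x ∈ Q ↔ Θ x = -x)
    {s : W → W → ℂ} (hadd : ∀ x y z, s (x + y) z = s x z + s y z) (hsymm : ∀ x y, s y x = starRingEnd ℂ (s x y))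
    (hPQ : ∀ p ∈ P, ∀ q ∈ Q, s p q = 0) (hdefP : ∀ p ∈ P, s p p = 0 → p = 0) (hdefQ : ∀ q ∈ Q, s q q = 0 → q = 0)
    (hadj : ∀ X ∈ 𝔊, ∃ Y ∈ 𝔊, ∀ x y, s (X x) y = s x (Y y))
    {B : Module.End ℂ W} (hB : B ∈ 𝔊) (hΘB : Θ * B = B) (hBΘ : B * Θ = -B)
    (hr0 : 0 < Module.finrank ℂ (LinearMap.range B))
    (hQ3 : 3 ≤ Module.finrank ℂ Q) (hba : Module.finrank ℂ Q < Module.finrank ℂ P)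
    (hcore : ∀ (U : Submodule ℂ W) (𝔩 : Submodule ℂ (Module.End ℂ U)) (ι : Module.End ℂ U) (P' Q' : Submodule ℂ U),
      (∀ A ∈ 𝔩, ∀ A' ∈ 𝔩, A * A' - A' * A ∈ 𝔩) →
      (∀ V : Submodule ℂ U, (∀ A ∈ 𝔩, ∀ u ∈ V, A u ∈ V) → V = ⊥ ∨ V = ⊤) →
      ι ∈ 𝔩 → ι * ι = 1 → (∀ x, x ∈ P' ↔ ι x = x) → (∀ x, x ∈ Q' ↔ ι x = -x) →
      Module.finrank ℂ P' = Module.finrank ℂ (LinearMap.range B) →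
      Module.finrank ℂ Q' + Module.finrank ℂ (LinearMap.range B) = Module.finrank ℂ P →
      (∀ p ∈ P', ∀ q ∈ Q', s (p : W) q = 0) → (∀ p ∈ P', s (p : W) p = 0 → p = 0) →
      (∀ q ∈ Q', s (q : W) q = 0 → q = 0) →
      (∀ A ∈ 𝔩, ∃ A' ∈ 𝔩, ∀ x y : U, s ((A x : U) : W) y = s x ((A' y : U) : W)) → 𝔩 = ⊤) : 𝔊 = ⊤ := by
  obtain ⟨C, hC, hBC⟩ := hadj B hB
  obtain ⟨hΘC, hCΘ⟩ := UnitaryTwoOdd.lower_of_adjoint hadd hsymm hΘΘ hP hQ hPQ hdefP hdefQ hΘB hBΘ hBC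
  have hraise : ∀ v, B v ∈ P := fun v => (hP _).2 (by rw [← Module.End.mul_apply, hΘB])
  have hlower : ∀ w, C w ∈ Q := fun w => (hQ _).2 (by rw [← Module.End.mul_apply, hΘC, LinearMap.neg_apply])
  have hrk : Module.finrank ℂ (LinearMap.range C) = Module.finrank ℂ (LinearMap.range B) :=
    (UnitaryAdjointRank.finrank_range_eq hadd hsymm hBC (fun v h => hdefP _ (hraise v) h)
      (fun w h => hdefQ _ (hlower w) h)).symm
  have hnΘ : -Θ ∈ 𝔊 := Submodule.neg_mem _ hΘ
  have hnΘΘ : (-Θ) * (-Θ) = 1 := by rw [neg_mul_neg, hΘΘ]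
  have hQ' : ∀ x, x ∈ Q ↔ (-Θ) x = x := fun x => by rw [hQ, LinearMap.neg_apply, neg_eq_iff_eq_neg]
  have hP' : ∀ x, x ∈ P ↔ (-Θ) x = -x := fun x => by rw [hP, LinearMap.neg_apply, neg_inj]
  have hQP : ∀ q ∈ Q, ∀ p ∈ P, s q p = 0 := fun q hq p hp => by rw [hsymm, hPQ p hp q hq, map_zero]
  have hΘC' : (-Θ) * C = C := by rw [neg_mul, hΘC, neg_neg]
  have hCΘ' : C * (-Θ) = -C := by rw [mul_neg, hCΘ]
  exact UnitaryDoubleLevi.eq_top_of_raise_of_core hbr hirr hnΘ hnΘΘ hQ' hP' hadd hsymm hQP hdefQ hdefP hadj hC hΘC'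
    hCΘ' (by rw [hrk]; exact hr0) hQ3 hba
    fun U 𝔩 ι P' Q' hbr𝔩 hirr𝔩 hι hιι hP'' hQ'' hfinP' hfinQ' hP'Q' hdefP' hdefQ' hadj𝔩 =>
      hcore U 𝔩 ι P' Q' hbr𝔩 hirr𝔩 hι hιι hP'' hQ'' (by rw [hfinP', hrk]) (by rw [← hrk]; exact hfinQ') hP'Q'
        hdefP' hdefQ' hadj𝔩

/-! ### §3 The Levi pair of a raising operator, packaged -/

/-- **The Levi pair of a raising operator.** For a raising `B ∈ 𝔊` in the unitary setting: its involution `ι ∈ 𝔊`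
(self-adjoint, commuting with `Θ`), `U⁻ = {ι = −1} = B(W) ⊕ (Q ∩ ker B)`, `U⁺ = {ι = 1} = PU ⊕ QU` with the four
pieces characterised by the signs of `(ι, Θ)` and their dimensions, the concrete Levi algebras `L⁻ = 𝔷|_{U⁻}` (type
`(r | b − r)`) and `L⁺ = 𝔷|_{U⁺}` (type `(a − r | r)`) with their unitary axioms, and the rank bookkeeping for raising
`X` commuting with `ι`: `rk X = rk X|_{U⁺} + rk X|_{U⁻}`, `rk X|_{U⁺} ≤ min(a − r, r)`, `rk X|_{U⁻} ≤ min(r, b − r)`.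
[cite: GoodmanWallachGTM255, §4.1.1] [cite: HoffmanKunze1971LinearAlgebra, §6.7, §3.1 Thm. 2]
[cite: Deligne1982HodgeCycles, I §3 Prop. 3.4, 3.6] -/
theorem UnitaryLeviSetup.exists_levi_pair [FiniteDimensional ℂ W] {𝔊 : Submodule ℂ (Module.End ℂ W)}
    (hbr : ∀ Y ∈ 𝔊, ∀ Z ∈ 𝔊, Y * Z - Z * Y ∈ 𝔊)
    (hirr : ∀ U : Submodule ℂ W, (∀ A ∈ 𝔊, ∀ u ∈ U, A u ∈ U) → U = ⊥ ∨ U = ⊤)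
    {Θ : Module.End ℂ W} (hΘ : Θ ∈ 𝔊) (hΘΘ : Θ * Θ = 1)
    {P Q : Submodule ℂ W} (hP : ∀ x, x ∈ P ↔ Θ x = x) (hQ : ∀ x, x ∈ Q ↔ Θ x = -x)
    {s : W → W → ℂ} (hadd : ∀ x y z, s (x + y) z = s x z + s y z) (hsymm : ∀ x y, s y x = starRingEnd ℂ (s x y))
    (hPQ : ∀ p ∈ P, ∀ q ∈ Q, s p q = 0) (hdefP : ∀ p ∈ P, s p p = 0 → p = 0) (hdefQ : ∀ q ∈ Q, s q q = 0 → q = 0)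
    (hadj : ∀ X ∈ 𝔊, ∃ Y ∈ 𝔊, ∀ x y, s (X x) y = s x (Y y))
    {B : Module.End ℂ W} (hB : B ∈ 𝔊) (hΘB : Θ * B = B) (hBΘ : B * Θ = -B) :
    ∃ (ι : Module.End ℂ W) (Um Up PU QU : Submodule ℂ W)
      (Lm : Submodule ℂ (Module.End ℂ Um)) (ιm : Module.End ℂ Um) (Pm Qm : Submodule ℂ Um)
      (Lp : Submodule ℂ (Module.End ℂ Up)) (ιp : Module.End ℂ Up) (Pp Qp : Submodule ℂ Up),
      -- (a) the involution and its eigenspaces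
      ι ∈ 𝔊 ∧ ι * ι = 1 ∧ ι * Θ = Θ * ι ∧ (∀ x y, s (ι x) y = s x (ι y)) ∧
      (∀ x, x ∈ Um ↔ ι x = -x) ∧ (∀ x, x ∈ Up ↔ ι x = x) ∧
      Module.finrank ℂ Um = Module.finrank ℂ Q ∧ Module.finrank ℂ Up = Module.finrank ℂ P ∧
      -- (b) the four pieces
      (∀ x, x ∈ LinearMap.range B ↔ ι x = -x ∧ Θ x = x) ∧ (∀ x, x ∈ Q ⊓ LinearMap.ker B ↔ ι x = -x ∧ Θ x = -x) ∧
      (∀ x, x ∈ PU ↔ ι x = x ∧ Θ x = x) ∧ (∀ x, x ∈ QU ↔ ι x = x ∧ Θ x = -x) ∧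
      LinearMap.range B ≤ P ∧ PU ≤ P ∧ QU ≤ Q ∧
      Module.finrank ℂ ↥(Q ⊓ LinearMap.ker B) + Module.finrank ℂ (LinearMap.range B) = Module.finrank ℂ Q ∧
      Module.finrank ℂ PU + Module.finrank ℂ (LinearMap.range B) = Module.finrank ℂ P ∧
      Module.finrank ℂ QU = Module.finrank ℂ (LinearMap.range B) ∧
      -- (c) the Levi algebras
      (∀ A, A ∈ Lm ↔ ∃ Z ∈ 𝔊, Z * ι = ι * Z ∧ ∀ x : Um, ((A x : Um) : W) = Z x) ∧
      (∀ A, A ∈ Lp ↔ ∃ Z ∈ 𝔊, Z * ι = ι * Z ∧ ∀ x : Up, ((A x : Up) : W) = Z x) ∧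
      -- (d) the axioms of `L⁻` (type `(r | b − r)`)
      (∀ x : Um, ((ιm x : Um) : W) = Θ x) ∧
      (∀ x : Um, x ∈ Pm ↔ (x : W) ∈ LinearMap.range B) ∧ (∀ x : Um, x ∈ Qm ↔ (x : W) ∈ Q ⊓ LinearMap.ker B) ∧
      (∀ A ∈ Lm, ∀ A' ∈ Lm, A * A' - A' * A ∈ Lm) ∧
      (∀ V : Submodule ℂ Um, (∀ A ∈ Lm, ∀ u ∈ V, A u ∈ V) → V = ⊥ ∨ V = ⊤) ∧
      ιm ∈ Lm ∧ ιm * ιm = 1 ∧ (∀ x, x ∈ Pm ↔ ιm x = x) ∧ (∀ x, x ∈ Qm ↔ ιm x = -x) ∧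
      Module.finrank ℂ Pm = Module.finrank ℂ (LinearMap.range B) ∧
      Module.finrank ℂ Qm + Module.finrank ℂ (LinearMap.range B) = Module.finrank ℂ Q ∧
      (∀ p ∈ Pm, ∀ q ∈ Qm, s (p : W) q = 0) ∧ (∀ p ∈ Pm, s (p : W) p = 0 → p = 0) ∧
      (∀ q ∈ Qm, s (q : W) q = 0 → q = 0) ∧
      (∀ A ∈ Lm, ∃ A' ∈ Lm, ∀ x y : Um, s ((A x : Um) : W) y = s x ((A' y : Um) : W)) ∧
      -- (e) the axioms of `L⁺` (type `(a − r | r)`)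
      (∀ x : Up, ((ιp x : Up) : W) = Θ x) ∧
      (∀ x : Up, x ∈ Pp ↔ (x : W) ∈ PU) ∧ (∀ x : Up, x ∈ Qp ↔ (x : W) ∈ QU) ∧
      (∀ A ∈ Lp, ∀ A' ∈ Lp, A * A' - A' * A ∈ Lp) ∧
      (∀ V : Submodule ℂ Up, (∀ A ∈ Lp, ∀ u ∈ V, A u ∈ V) → V = ⊥ ∨ V = ⊤) ∧
      ιp ∈ Lp ∧ ιp * ιp = 1 ∧ (∀ x, x ∈ Pp ↔ ιp x = x) ∧ (∀ x, x ∈ Qp ↔ ιp x = -x) ∧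
      Module.finrank ℂ Pp + Module.finrank ℂ (LinearMap.range B) = Module.finrank ℂ P ∧
      Module.finrank ℂ Qp = Module.finrank ℂ (LinearMap.range B) ∧
      (∀ p ∈ Pp, ∀ q ∈ Qp, s (p : W) q = 0) ∧ (∀ p ∈ Pp, s (p : W) p = 0 → p = 0) ∧
      (∀ q ∈ Qp, s (q : W) q = 0 → q = 0) ∧
      (∀ A ∈ Lp, ∃ A' ∈ Lp, ∀ x y : Up, s ((A x : Up) : W) y = s x ((A' y : Up) : W)) ∧
      -- (f) rank bookkeeping for raising operators commuting with `ι`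
      (∀ X : Module.End ℂ W, Θ * X = X → X * Θ = -X → X * ι = ι * X →
        Module.finrank ℂ (LinearMap.range X) = Module.finrank ℂ (Up.map X) + Module.finrank ℂ (Um.map X) ∧
        Module.finrank ℂ (Up.map X) + Module.finrank ℂ (LinearMap.range B) ≤ Module.finrank ℂ P ∧
        Module.finrank ℂ (Up.map X) ≤ Module.finrank ℂ (LinearMap.range B) ∧
        Module.finrank ℂ (Um.map X) ≤ Module.finrank ℂ (LinearMap.range B) ∧
        Module.finrank ℂ (Um.map X) + Module.finrank ℂ (LinearMap.range B) ≤ Module.finrank ℂ Q) := by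
  classical
  obtain ⟨haddr, h0r, h0l, hnegr, hnegl, hsubr, hsubl⟩ := UnitaryTwoOdd.herm_right hadd hsymm
  have hΘΘv : ∀ v, Θ (Θ v) = v := fun v => by rw [← Module.End.mul_apply, hΘΘ, Module.End.one_apply]
  -- the involution
  obtain ⟨C, hC, ι, hιmem, hBC, hΘC, hCΘ, hιι, hιΘ, hιs, hιa, hιd, hιb, hιc, hmemA, hmemD, hmemB, hmemC, hfinP₀, hfinQ₀,
    hfinQU, hrangeP, hmapCQ, hfinUm, hfinUp⟩ :=
    UnitaryLeviKernel.exists_involution hbr hΘ hΘΘ hP hQ hadd hsymm hPQ hdefP hdefQ hadj hB hΘB hBΘ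
  have hιv : ∀ v, ι (ι v) = v := fun v => by rw [← Module.End.mul_apply, hιι, Module.End.one_apply]
  set Um : Submodule ℂ W := LinearMap.ker (ι + 1) with hUmdef
  set Up : Submodule ℂ W := LinearMap.ker (ι - 1) with hUpdef
  have hUm : ∀ x, x ∈ Um ↔ ι x = -x := fun x => by
    rw [hUmdef, LinearMap.mem_ker, LinearMap.add_apply, Module.End.one_apply, add_eq_zero_iff_eq_neg]
  have hUp : ∀ x, x ∈ Up ↔ ι x = x := fun x => by
    rw [hUpdef, LinearMap.mem_ker, LinearMap.sub_apply, Module.End.one_apply, sub_eq_zero]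
  have hcm : ∀ Z : Module.End ℂ W, Z * ι = ι * Z → ∀ x ∈ Um, Z x ∈ Um := fun Z hZ x hx =>
    (hUm _).2 (by rw [← Module.End.mul_apply, ← hZ, Module.End.mul_apply, (hUm x).1 hx, map_neg])
  have hcp : ∀ Z : Module.End ℂ W, Z * ι = ι * Z → ∀ x ∈ Up, Z x ∈ Up := fun Z hZ x hx =>
    (hUp _).2 (by rw [← Module.End.mul_apply, ← hZ, Module.End.mul_apply, (hUp x).1 hx])
  obtain ⟨Im, Ip, Lm, Lp, -, -, hLm, hLp, -⟩ := UnitaryLeviKernel.exists_kernel_levi 𝔊 hιι hUm hUp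
  -- (b) the four pieces
  have hPM : ∀ x, x ∈ LinearMap.range B ↔ ι x = -x ∧ Θ x = x := fun x =>
    ⟨fun hx => ⟨hιa x hx, (hP x).1 (hrangeP hx)⟩, fun h => hmemA x h.1 h.2⟩
  have hQM : ∀ x, x ∈ Q ⊓ LinearMap.ker B ↔ ι x = -x ∧ Θ x = -x := fun x =>
    ⟨fun hx => ⟨hιd x hx, (hQ x).1 (Submodule.mem_inf.1 hx).1⟩, fun h => hmemD x h.1 h.2⟩
  have hPU : ∀ x, x ∈ P ⊓ LinearMap.ker C ↔ ι x = x ∧ Θ x = x := fun x =>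
    ⟨fun hx => ⟨hιb x hx, (hP x).1 (Submodule.mem_inf.1 hx).1⟩, fun h => hmemB x h.1 h.2⟩
  have hQU : ∀ x, x ∈ P.map C ↔ ι x = x ∧ Θ x = -x := fun x =>
    ⟨fun hx => ⟨hιc x hx, (hQ x).1 (hmapCQ hx)⟩, fun h => hmemC x h.1 h.2⟩
  -- (d) the concrete Levi algebra `L⁻`
  have hPUle : LinearMap.range B ≤ Um := fun x hx => (hUm x).2 (hιa x hx)
  have hQUle : Q ⊓ LinearMap.ker B ≤ Um := fun d hd => (hUm d).2 (hιd d hd)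
  have hPUmem : ∀ x ∈ Um, Θ x = x → x ∈ LinearMap.range B := fun x hx hΘx => hmemA x ((hUm x).1 hx) hΘx
  have hPUΘ : ∀ x ∈ LinearMap.range B, Θ x = x := fun x hx => (hP x).1 (hrangeP hx)
  have hQUmem : ∀ x ∈ Um, Θ x = -x → x ∈ Q ⊓ LinearMap.ker B := fun x hx hΘx => hmemD x ((hUm x).1 hx) hΘx
  have hQUΘ : ∀ x ∈ Q ⊓ LinearMap.ker B, Θ x = -x := fun x hx => (hQ x).1 (Submodule.mem_inf.1 hx).1
  have hPUQU : ∀ x ∈ LinearMap.range B, ∀ y ∈ Q ⊓ LinearMap.ker B, s x y = 0 := fun x hx y hy =>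
    hPQ x (hrangeP hx) y (Submodule.mem_inf.1 hy).1
  have hdefPU : ∀ x ∈ LinearMap.range B, s x x = 0 → x = 0 := fun x hx h => hdefP x (hrangeP hx) h
  have hdefQU : ∀ y ∈ Q ⊓ LinearMap.ker B, s y y = 0 → y = 0 := fun y hy h =>
    hdefQ y (Submodule.mem_inf.1 hy).1 h
  obtain ⟨ιm, Pm, Qm, hιmapply, hPmmem, hQmmem, hbrLm, hirrLm, hιmmem, hιmιm, hPm, hQm, hfinPm, hfinQm, hPmQm, hdefPm,
    hdefQm, hadjLm, -, -⟩ :=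
    UnitaryLeviFull.levi_axioms hbr hirr hΘΘ hP hQ hadd hsymm hPQ hdefP hdefQ hadj hιmem hιι hιs hΘ hΘΘ hιΘ hUm hPUle
      hQUle hPUmem hPUΘ hQUmem hQUΘ hPUQU hdefPU hdefQU hLm
  -- (e) the concrete Levi algebra `L⁺` (involution `−ι`)
  have hnι : -ι ∈ 𝔊 := Submodule.neg_mem _ hιmem
  have hnιι : (-ι) * (-ι) = 1 := by rw [neg_mul_neg, hιι]
  have hnιs : ∀ v w, s ((-ι) v) w = s v ((-ι) w) := fun v w => by
    rw [LinearMap.neg_apply, LinearMap.neg_apply, hnegl, hnegr, hιs]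
  have hnιΘ : (-ι) * Θ = Θ * (-ι) := by rw [neg_mul, mul_neg, hιΘ]
  have hUp' : ∀ v, v ∈ Up ↔ (-ι) v = -v := fun v => by rw [hUp, LinearMap.neg_apply, neg_inj]
  have hPUle' : P ⊓ LinearMap.ker C ≤ Up := fun v hv => (hUp v).2 (hιb v hv)
  have hQUle' : P.map C ≤ Up := fun v hv => (hUp v).2 (hιc v hv)
  have hPUmem' : ∀ v ∈ Up, Θ v = v → v ∈ P ⊓ LinearMap.ker C := fun v hv hΘv => hmemB v ((hUp v).1 hv) hΘv
  have hPUΘ' : ∀ v ∈ P ⊓ LinearMap.ker C, Θ v = v := fun v hv => (hP v).1 (Submodule.mem_inf.1 hv).1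
  have hQUmem' : ∀ v ∈ Up, Θ v = -v → v ∈ P.map C := fun v hv hΘv => hmemC v ((hUp v).1 hv) hΘv
  have hQUΘ' : ∀ v ∈ P.map C, Θ v = -v := fun v hv => (hQ v).1 (hmapCQ hv)
  have hPUQU' : ∀ v ∈ P ⊓ LinearMap.ker C, ∀ w ∈ P.map C, s v w = 0 := fun v hv w hw =>
    hPQ v (Submodule.mem_inf.1 hv).1 w (hmapCQ hw)
  have hdefPU' : ∀ v ∈ P ⊓ LinearMap.ker C, s v v = 0 → v = 0 := fun v hv h =>
    hdefP v (Submodule.mem_inf.1 hv).1 h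
  have hdefQU' : ∀ w ∈ P.map C, s w w = 0 → w = 0 := fun w hw h => hdefQ w (hmapCQ hw) h
  have hLp' : ∀ A, A ∈ Lp ↔ ∃ Z ∈ 𝔊, Z * (-ι) = (-ι) * Z ∧ ∀ v : Up, ((A v : Up) : W) = Z v := fun A => by
    rw [hLp]
    constructor
    · rintro ⟨Z, hZ, hZc, hZv⟩; exact ⟨Z, hZ, by rw [mul_neg, neg_mul, hZc], hZv⟩
    · rintro ⟨Z, hZ, hZc, hZv⟩; exact ⟨Z, hZ, by rw [mul_neg, neg_mul, neg_inj] at hZc; exact hZc, hZv⟩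
  obtain ⟨ιp, Pp, Qp, hιpapply, hPpmem, hQpmem, hbrLp, hirrLp, hιpmem, hιpιp, hPp, hQp, hfinPp, hfinQp, hPpQp, hdefPp,
    hdefQp, hadjLp, -, -⟩ :=
    UnitaryLeviFull.levi_axioms hbr hirr hΘΘ hP hQ hadd hsymm hPQ hdefP hdefQ hadj hnι hnιι hnιs hΘ hΘΘ hnιΘ hUp'
      hPUle' hQUle' hPUmem' hPUΘ' hQUmem' hQUΘ' hPUQU' hdefPU' hdefQU' hLp'
  -- (f) rank bookkeeping
  have hkill : ∀ X : Module.End ℂ W, X * Θ = -X → ∀ p, Θ p = p → X p = 0 := fun X hXΘ p hp => by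
    have h : X p = -(X p) := by
      conv_lhs => rw [← hp, ← Module.End.mul_apply, hXΘ, LinearMap.neg_apply]
    have h2 : (2 : ℂ) • X p = 0 := by rw [two_smul]; nth_rewrite 2 [h]; rw [add_neg_cancel]
    exact (smul_eq_zero.1 h2).resolve_left two_ne_zero
  have hsplit : ∀ X : Module.End ℂ W, Θ * X = X → X * Θ = -X → X * ι = ι * X →
      Module.finrank ℂ (LinearMap.range X) = Module.finrank ℂ (Up.map X) + Module.finrank ℂ (Um.map X) ∧
        Module.finrank ℂ (Up.map X) + Module.finrank ℂ (LinearMap.range B) ≤ Module.finrank ℂ P ∧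
        Module.finrank ℂ (Up.map X) ≤ Module.finrank ℂ (LinearMap.range B) ∧
        Module.finrank ℂ (Um.map X) ≤ Module.finrank ℂ (LinearMap.range B) ∧
        Module.finrank ℂ (Um.map X) + Module.finrank ℂ (LinearMap.range B) ≤ Module.finrank ℂ Q := by
    intro X hΘX hXΘ hXc
    have hXval : ∀ v, X v = X ((2 : ℂ)⁻¹ • (v - Θ v)) := fun v => by
      have hv : v = (2 : ℂ)⁻¹ • (v + Θ v) + (2 : ℂ)⁻¹ • (v - Θ v) := by module
      have hp : Θ ((2 : ℂ)⁻¹ • (v + Θ v)) = (2 : ℂ)⁻¹ • (v + Θ v) := by rw [map_smul, map_add, hΘΘv, add_comm]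
      conv_lhs => rw [hv, map_add, hkill X hXΘ _ hp, zero_add]
    have hodd : ∀ v, Θ ((2 : ℂ)⁻¹ • (v - Θ v)) = -((2 : ℂ)⁻¹ • (v - Θ v)) := fun v => by
      rw [map_smul, map_sub, hΘΘv, ← smul_neg, neg_sub]
    have hιodd : ∀ v, ι ((2 : ℂ)⁻¹ • (v - Θ v)) = (2 : ℂ)⁻¹ • (ι v - Θ (ι v)) := fun v => by
      rw [map_smul, map_sub, ← Module.End.mul_apply, hιΘ, Module.End.mul_apply]
    refine ⟨UnitaryLeviRank.finrank_range_eq_add hιι hUm hUp hXc, ?_, ?_, ?_, ?_⟩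
    · have hle : Up.map X ≤ P ⊓ LinearMap.ker C := by
        rintro _ ⟨x, hx, rfl⟩
        exact hmemB _ ((hUp _).1 (hcp X hXc x hx)) (by rw [← Module.End.mul_apply, hΘX])
      have := Submodule.finrank_mono hle
      omega
    · have hle : Up.map X ≤ (P.map C).map X := by
        rintro _ ⟨x, hx, rfl⟩
        refine ⟨(2 : ℂ)⁻¹ • (x - Θ x), hmemC _ ?_ (hodd x), (hXval x).symm⟩
        rw [hιodd, (hUp x).1 hx]
      exact (Submodule.finrank_mono hle).trans ((Submodule.finrank_map_le _ _).trans hfinQU.le)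
    · have hle : Um.map X ≤ LinearMap.range B := by
        rintro _ ⟨x, hx, rfl⟩
        exact hmemA _ ((hUm _).1 (hcm X hXc x hx)) (by rw [← Module.End.mul_apply, hΘX])
      exact Submodule.finrank_mono hle
    · have hle : Um.map X ≤ (Q ⊓ LinearMap.ker B).map X := by
        rintro _ ⟨x, hx, rfl⟩
        refine ⟨(2 : ℂ)⁻¹ • (x - Θ x), hmemD _ ?_ (hodd x), (hXval x).symm⟩
        rw [hιodd, (hUm x).1 hx, map_neg]
        module
      have := (Submodule.finrank_mono hle).trans (Submodule.finrank_map_le _ _)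
      omega
  refine ⟨ι, Um, Up, P ⊓ LinearMap.ker C, P.map C, Lm, ιm, Pm, Qm, Lp, ιp, Pp, Qp, hιmem, hιι, hιΘ, hιs, hUm, hUp,
    hfinUm, hfinUp, hPM, hQM, hPU, hQU, hrangeP, fun x hx => (Submodule.mem_inf.1 hx).1, hmapCQ, hfinQ₀, ?_,
    hfinQU, hLm, hLp, hιmapply, hPmmem, hQmmem, hbrLm, hirrLm, hιmmem, hιmιm, hPm, hQm, hfinPm, ?_, hPmQm, hdefPm,
    hdefQm, hadjLm, hιpapply, hPpmem, hQpmem, hbrLp, hirrLp, hιpmem, hιpιp, hPp, hQp, ?_, ?_, hPpQp, hdefPp, hdefQp,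
    hadjLp, hsplit⟩
  · omega
  · rw [hfinQm]; exact hfinQ₀
  · rw [hfinPp]; omega
  · rw [hfinQp, hfinQU]

/-! ### §4 TOOL E: the pencil trick under a full Levi algebra -/

/-- Three «independent» vectors in a subspace of dimension `≥ 3`: `u ≠ 0`, `v ∉ ℂu`, `w ∉ ℂu + ℂv`.
[cite: HoffmanKunze1971LinearAlgebra, §2.3] -/
theorem UnitaryPencil.exists_triple_of_three_le_finrank [FiniteDimensional ℂ W] (S : Submodule ℂ W)
    (h3 : 3 ≤ Module.finrank ℂ S) :
    ∃ u ∈ S, ∃ v ∈ S, ∃ w ∈ S, u ≠ 0 ∧ v ∉ ℂ ∙ u ∧ w ∉ Submodule.span ℂ ({u, v} : Set W) := by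
  classical
  obtain ⟨u, hu, v, hv, hu0, hvu⟩ := UnitaryPencil.exists_pair_of_two_le_finrank S (by omega)
  by_contra hne
  push Not at hne
  have hle : S ≤ Submodule.span ℂ ({u, v} : Set W) := fun w hw => hne u hu v hv w hw hu0 hvu
  have h2 : Module.finrank ℂ (Submodule.span ℂ ({u, v} : Set W)) ≤ 2 := by
    have h := finrank_span_finset_le_card (R := ℂ) ({u, v} : Finset W)
    rw [Finset.coe_pair] at h
    exact h.trans Finset.card_le_two
  have := Submodule.finrank_mono hle
  omega

/-- **TOOL E — the pencil trick under a full Levi algebra.** Let `ι` be an involution commuting with `Θ`,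
`U^± = {ι = ±1}`, and suppose the Levi algebra on `U⁺` is FULL (`hfull`: every endomorphism of `U⁺` is the restriction
of an element of `𝔊` commuting with `ι`), and that `PU = P ∩ U⁺` and `QU = Q ∩ U⁺` have dimension `≥ 3`. Then no
threshold `k` satisfies both «every raising `X ∈ 𝔊` commuting with `ι` with `rk X|_{U⁺} = 2` has `rk X|_{U⁻} ≥ k`» and
«every such `X` with `rk X|_{U⁺} = 3` has `rk X|_{U⁻} < k`». Proof: lift (`UnitaryLeviFull.exists_raise_lift`)
`X = χ₁ ⊗ e₁ + χ₂ ⊗ e₂` and `X' = χ₃ ⊗ e₃` for three independent `eₖ ∈ PU` and the dual triple `χₖ` of three basis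
vectors of `QU`; `rk X|_{U⁺} = 2`, `rk (X + cX')|_{U⁺} = 3` for `c ≠ 0`, while `rk (X + cX')|_{U⁻} ≥ rk X|_{U⁻}` off a
finite set of `c` (`UnitaryGenericRank.exists_finset_finrank_le_add_smul'`). [cite: Ribet1983, Thm. 3]
[cite: GoodmanWallachGTM255, §4.1.1] [cite: HoffmanKunze1971LinearAlgebra, §3.5–3.6, §3.1 Thm. 2] -/
theorem UnitaryLeviPencil.false_of_full [FiniteDimensional ℂ W] {𝔊 : Submodule ℂ (Module.End ℂ W)}
    (hbr : ∀ Y ∈ 𝔊, ∀ Z ∈ 𝔊, Y * Z - Z * Y ∈ 𝔊)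
    {Θ : Module.End ℂ W} (hΘ : Θ ∈ 𝔊) (hΘΘ : Θ * Θ = 1)
    {ι : Module.End ℂ W} (hιΘ : ι * Θ = Θ * ι)
    {Um Up : Submodule ℂ W} (hUm : ∀ x, x ∈ Um ↔ ι x = -x) (hUp : ∀ x, x ∈ Up ↔ ι x = x)
    (hfull : ∀ T : Module.End ℂ Up, ∃ Z ∈ 𝔊, Z * ι = ι * Z ∧ ∀ x : Up, ((T x : Up) : W) = Z x)
    {PU QU : Submodule ℂ W} (hPU : ∀ x, x ∈ PU ↔ ι x = x ∧ Θ x = x) (hQU : ∀ x, x ∈ QU ↔ ι x = x ∧ Θ x = -x)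
    (hPU3 : 3 ≤ Module.finrank ℂ PU) (hQU3 : 3 ≤ Module.finrank ℂ QU) (k : ℕ)
    (h2 : ∀ X ∈ 𝔊, Θ * X = X → X * Θ = -X → X * ι = ι * X → Module.finrank ℂ (Up.map X) = 2 →
      k ≤ Module.finrank ℂ (Um.map X))
    (h3 : ∀ X ∈ 𝔊, Θ * X = X → X * Θ = -X → X * ι = ι * X → Module.finrank ℂ (Up.map X) = 3 →
      Module.finrank ℂ (Um.map X) < k) : False := by
  classical
  have hΘΘv : ∀ v, Θ (Θ v) = v := fun v => by rw [← Module.End.mul_apply, hΘΘ, Module.End.one_apply]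
  have hcm : ∀ Z : Module.End ℂ W, Z * ι = ι * Z → ∀ x ∈ Um, Z x ∈ Um := fun Z hZ x hx =>
    (hUm _).2 (by rw [← Module.End.mul_apply, ← hZ, Module.End.mul_apply, (hUm x).1 hx, map_neg])
  have hkill : ∀ X : Module.End ℂ W, X * Θ = -X → ∀ p, Θ p = p → X p = 0 := fun X hXΘ p hp => by
    have h : X p = -(X p) := by
      conv_lhs => rw [← hp, ← Module.End.mul_apply, hXΘ, LinearMap.neg_apply]
    have h2 : (2 : ℂ) • X p = 0 := by rw [two_smul]; nth_rewrite 2 [h]; rw [add_neg_cancel]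
    exact (smul_eq_zero.1 h2).resolve_left two_ne_zero
  -- the values of an operator killing `P` on `U⁺` are values on `QU`
  have hval : ∀ X : Module.End ℂ W, X * Θ = -X → ∀ v ∈ Up, ∃ q, ι q = q ∧ Θ q = -q ∧ X v = X q := by
    intro X hXΘ v hv
    refine ⟨(2 : ℂ)⁻¹ • (v - Θ v), ?_, ?_, ?_⟩
    · rw [map_smul, map_sub, ← Module.End.mul_apply, hιΘ, Module.End.mul_apply, (hUp v).1 hv]
    · rw [map_smul, map_sub, hΘΘv, ← smul_neg, neg_sub]
    · have hv' : v = (2 : ℂ)⁻¹ • (v + Θ v) + (2 : ℂ)⁻¹ • (v - Θ v) := by module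
      have hp : Θ ((2 : ℂ)⁻¹ • (v + Θ v)) = (2 : ℂ)⁻¹ • (v + Θ v) := by rw [map_smul, map_add, hΘΘv, add_comm]
      conv_lhs => rw [hv', map_add, hkill X hXΘ _ hp, zero_add]
  -- three independent vectors of `PU`
  obtain ⟨e₁, he₁, e₂, he₂, e₃, he₃, he₁0, he₂1, he₃12⟩ := UnitaryPencil.exists_triple_of_three_le_finrank PU hPU3
  obtain ⟨hιe₁, hΘe₁⟩ := (hPU e₁).1 he₁
  obtain ⟨hιe₂, hΘe₂⟩ := (hPU e₂).1 he₂
  obtain ⟨hιe₃, hΘe₃⟩ := (hPU e₃).1 he₃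
  have hS₁ : Module.finrank ℂ (ℂ ∙ e₁) = 1 := finrank_span_singleton he₁0
  have hS₂le : Module.finrank ℂ (Submodule.span ℂ ({e₁, e₂} : Set W)) ≤ 2 := by
    have h := finrank_span_finset_le_card (R := ℂ) ({e₁, e₂} : Finset W)
    rw [Finset.coe_pair] at h
    exact h.trans Finset.card_le_two
  have hS₃le : Module.finrank ℂ (Submodule.span ℂ ({e₁, e₂, e₃} : Set W)) ≤ 3 := by
    have h := finrank_span_finset_le_card (R := ℂ) ({e₁, e₂, e₃} : Finset W)
    rw [Finset.coe_insert, Finset.coe_pair] at h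
    exact h.trans Finset.card_le_three
  have hlt₁₂ : (ℂ ∙ e₁) < Submodule.span ℂ ({e₁, e₂} : Set W) :=
    SetLike.lt_iff_le_and_exists.2 ⟨Submodule.span_mono (Set.singleton_subset_iff.2 (Set.mem_insert _ _)), e₂,
      Submodule.subset_span (Set.mem_insert_of_mem _ (Set.mem_singleton _)), he₂1⟩
  have hlt₂₃ : Submodule.span ℂ ({e₁, e₂} : Set W) < Submodule.span ℂ ({e₁, e₂, e₃} : Set W) :=
    SetLike.lt_iff_le_and_exists.2 ⟨Submodule.span_mono (Set.insert_subset_insert (Set.singleton_subset_iff.2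
      (Set.mem_insert _ _))), e₃, Submodule.subset_span (Set.mem_insert_of_mem _ (Set.mem_insert_of_mem _
      (Set.mem_singleton _))), he₃12⟩
  have hS₂ : Module.finrank ℂ (Submodule.span ℂ ({e₁, e₂} : Set W)) = 2 := by
    have := Submodule.finrank_lt_finrank_of_lt hlt₁₂
    omega
  have hS₃ : Module.finrank ℂ (Submodule.span ℂ ({e₁, e₂, e₃} : Set W)) = 3 := by
    have := Submodule.finrank_lt_finrank_of_lt hlt₂₃
    omega
  -- three basis vectors of `QU` and their dual triple
  set n : ℕ := Module.finrank ℂ QU with hndef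
  let b := Module.finBasis ℂ QU
  have hn : 3 ≤ n := hQU3
  set i₁ : Fin n := ⟨0, by omega⟩ with hi₁
  set i₂ : Fin n := ⟨1, by omega⟩ with hi₂
  set i₃ : Fin n := ⟨2, by omega⟩ with hi₃
  have h12 : i₁ ≠ i₂ := fun h => by rw [hi₁, hi₂, Fin.ext_iff] at h; exact absurd h (by norm_num)
  have h13 : i₁ ≠ i₃ := fun h => by rw [hi₁, hi₃, Fin.ext_iff] at h; exact absurd h (by norm_num)
  have h23 : i₂ ≠ i₃ := fun h => by rw [hi₂, hi₃, Fin.ext_iff] at h; exact absurd h (by norm_num)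
  have hχ : ∀ i j : Fin n, Subspace.dualLift QU (b.coord i) ((b j : QU) : W) = if j = i then 1 else 0 := by
    intro i j
    rw [Subspace.dualLift_of_subtype, Basis.coord_apply, Basis.repr_self, Finsupp.single_apply]
  have hq : ∀ j : Fin n, ι ((b j : QU) : W) = (b j : QU) ∧ Θ ((b j : QU) : W) = -((b j : QU) : W) := fun j =>
    (hQU _).1 (b j).2
  have hqUp : ∀ j : Fin n, ((b j : QU) : W) ∈ Up := fun j => (hUp _).2 (hq j).1
  -- the lifts
  obtain ⟨X₁, hX₁, hΘX₁, hX₁Θ, hX₁c, hX₁v⟩ := UnitaryLeviFull.exists_raise_lift hbr hΘ hΘΘ hιΘ hUp hfull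
    (Subspace.dualLift QU (b.coord i₁)) hΘe₁ hιe₁
  obtain ⟨X₂, hX₂, hΘX₂, hX₂Θ, hX₂c, hX₂v⟩ := UnitaryLeviFull.exists_raise_lift hbr hΘ hΘΘ hιΘ hUp hfull
    (Subspace.dualLift QU (b.coord i₂)) hΘe₂ hιe₂
  obtain ⟨X₃, hX₃, hΘX₃, hX₃Θ, hX₃c, hX₃v⟩ := UnitaryLeviFull.exists_raise_lift hbr hΘ hΘΘ hιΘ hUp hfull
    (Subspace.dualLift QU (b.coord i₃)) hΘe₃ hιe₃
  -- the pencil `X + c X'`, `X = X₁ + X₂`, `X' = X₃`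
  set Xc : ℂ → Module.End ℂ W := fun c => X₁ + X₂ + c • X₃ with hXcdef
  have hXc : ∀ c, Xc c ∈ 𝔊 := fun c => Submodule.add_mem _ (Submodule.add_mem _ hX₁ hX₂) (Submodule.smul_mem _ _ hX₃)
  have hΘXc : ∀ c, Θ * Xc c = Xc c := fun c => by
    simp only [hXcdef, mul_add, mul_smul_comm, hΘX₁, hΘX₂, hΘX₃]
  have hXcΘ : ∀ c, Xc c * Θ = -(Xc c) := fun c => by
    simp only [hXcdef, add_mul, smul_mul_assoc, hX₁Θ, hX₂Θ, hX₃Θ, smul_neg, neg_add]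
  have hXcc : ∀ c, Xc c * ι = ι * Xc c := fun c => by
    simp only [hXcdef, add_mul, smul_mul_assoc, mul_add, mul_smul_comm, hX₁c, hX₂c, hX₃c]
  have hXcq : ∀ c q, ι q = q → Θ q = -q →
      Xc c q = Subspace.dualLift QU (b.coord i₁) q • e₁ + Subspace.dualLift QU (b.coord i₂) q • e₂ +
        c • (Subspace.dualLift QU (b.coord i₃) q • e₃) := fun c q hιq hΘq => by
    simp only [hXcdef, LinearMap.add_apply, LinearMap.smul_apply, hX₁v q hιq hΘq, hX₂v q hιq hΘq, hX₃v q hιq hΘq]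
  have hXcq₁ : ∀ c, Xc c ((b i₁ : QU) : W) = e₁ := fun c => by
    rw [hXcq c _ (hq i₁).1 (hq i₁).2, hχ, hχ, hχ, if_pos rfl, if_neg h12, if_neg h13]; module
  have hXcq₂ : ∀ c, Xc c ((b i₂ : QU) : W) = e₂ := fun c => by
    rw [hXcq c _ (hq i₂).1 (hq i₂).2, hχ, hχ, hχ, if_neg h12.symm, if_pos rfl, if_neg h23]; module
  have hXcq₃ : ∀ c, Xc c ((b i₃ : QU) : W) = c • e₃ := fun c => by
    rw [hXcq c _ (hq i₃).1 (hq i₃).2, hχ, hχ, hχ, if_neg h13.symm, if_neg h23.symm, if_pos rfl]; module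
  -- `rk X|_{U⁺} = 2`
  have hUp0 : Up.map (Xc 0) = Submodule.span ℂ ({e₁, e₂} : Set W) := by
    apply le_antisymm
    · rintro _ ⟨v, hv, rfl⟩
      obtain ⟨q, hιq, hΘq, hvq⟩ := hval (Xc 0) (hXcΘ 0) v hv
      rw [hvq, hXcq 0 q hιq hΘq, zero_smul, add_zero]
      exact Submodule.add_mem _ (Submodule.smul_mem _ _ (Submodule.subset_span (Set.mem_insert _ _)))
        (Submodule.smul_mem _ _ (Submodule.subset_span (Set.mem_insert_of_mem _ (Set.mem_singleton _))))
    · rw [Submodule.span_le]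
      rintro x hx
      rcases hx with rfl | rfl
      · exact ⟨_, hqUp i₁, hXcq₁ 0⟩
      · exact ⟨_, hqUp i₂, hXcq₂ 0⟩
  have hrk0 : Module.finrank ℂ (Up.map (Xc 0)) = 2 := by rw [hUp0, hS₂]
  -- `rk (X + cX')|_{U⁺} = 3` for `c ≠ 0`
  have hUpc : ∀ c ≠ (0 : ℂ), Up.map (Xc c) = Submodule.span ℂ ({e₁, e₂, e₃} : Set W) := by
    intro c hc
    apply le_antisymm
    · rintro _ ⟨v, hv, rfl⟩
      obtain ⟨q, hιq, hΘq, hvq⟩ := hval (Xc c) (hXcΘ c) v hv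
      rw [hvq, hXcq c q hιq hΘq]
      exact Submodule.add_mem _ (Submodule.add_mem _
        (Submodule.smul_mem _ _ (Submodule.subset_span (Set.mem_insert _ _)))
        (Submodule.smul_mem _ _ (Submodule.subset_span (Set.mem_insert_of_mem _ (Set.mem_insert _ _)))))
        (Submodule.smul_mem _ _ (Submodule.smul_mem _ _ (Submodule.subset_span
          (Set.mem_insert_of_mem _ (Set.mem_insert_of_mem _ (Set.mem_singleton _))))))
    · rw [Submodule.span_le]
      rintro x hx
      rcases hx with rfl | rfl | rfl
      · exact ⟨_, hqUp i₁, hXcq₁ c⟩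
      · exact ⟨_, hqUp i₂, hXcq₂ c⟩
      · exact ⟨_, Submodule.smul_mem _ _ (hqUp i₃), by rw [map_smul, hXcq₃, smul_smul, inv_mul_cancel₀ hc, one_smul]⟩
  have hrkc : ∀ c ≠ (0 : ℂ), Module.finrank ℂ (Up.map (Xc c)) = 3 := fun c hc => by rw [hUpc c hc, hS₃]
  -- generic rank on `U⁻`
  set y : Module.End ℂ Um := (Xc 0).restrict (hcm _ (hXcc 0)) with hydef
  set y' : Module.End ℂ Um := X₃.restrict (hcm _ hX₃c) with hy'def
  obtain ⟨S, hS⟩ := UnitaryGenericRank.exists_finset_finrank_le_add_smul' y y'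
  obtain ⟨c, hc⟩ := Infinite.exists_notMem_finset (insert 0 S)
  rw [Finset.mem_insert, not_or] at hc
  have hres : (Xc c).restrict (hcm _ (hXcc c)) = y + c • y' := LinearMap.ext fun v => Subtype.ext (by
    simp only [LinearMap.coe_restrict_apply, hXcdef, LinearMap.add_apply, LinearMap.smul_apply, Submodule.coe_add,
      Submodule.coe_smul, hydef, hy'def, zero_smul, add_zero])
  have h1 : Module.finrank ℂ (LinearMap.range y) = Module.finrank ℂ (Um.map (Xc 0)) := by
    rw [hydef, UnitaryLeviRank.finrank_range_restrict]
  have h2' : Module.finrank ℂ (LinearMap.range (y + c • y')) = Module.finrank ℂ (Um.map (Xc c)) := by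
    rw [← hres, UnitaryLeviRank.finrank_range_restrict]
  have hk0 := h2 (Xc 0) (hXc 0) (hΘXc 0) (hXcΘ 0) (hXcc 0) hrk0
  have hkc := h3 (Xc c) (hXc c) (hΘXc c) (hXcΘ c) (hXcc c) (hrkc c hc.1)
  have hle := hS c hc.2
  omega

end HodgeStructure

end Literature.AlgebraicGeometry.Motives

end
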